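import Summits.NavierStokesRegularity.NavierStokesRegularity.Theorems.ExtremiserTransiencePerFlowEfficiencyForcesPalinstrophy
import Summits.NavierStokesRegularity.NavierStokesRegularity.Theorems.ExtremiserTransiencePerFlowEfficiencyCapsPalinstrophy
import HarnessLib

/-!
# Route `ExtremiserTransience`, LINE g4-α «per-flow-tangent» (ns-idea-5 g4): THE SCALE LOCK REDUCED —
# two-sided lock at near-efficient late times from (gradient Type-I rate) + (Leray's lower rate) + (Leray-rate enstrophy AT efficient times)

`--supports stmt-NavierStokesRegularity-26568` (`TangentExtremalExtraction`; skeleton v2 stub `stub_scaleLock`).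

`stub_scaleLock` (skeleton v2 of the per-flow tangent line) asks, for a flow violating the per-flow conclusion
of `NearExtremalTransiencePerFlow`, for non-null sets of late times that are near-efficient AND two-sided
scale-locked, `c₁ν(T−t)·P ≤ Z ≤ c₂ν(T−t)·P` (`Z = ‖ω‖₂²`, `P = ‖∇ω‖₂²`), with `c₁, c₂` independent of the
efficiency level and of the onset. This file PROVES that conclusion from three inputs, isolating the open one:

* (G) a GRADIENT Type-I rate `(T−t)·‖∇u(t,x)‖ ≤ C₁` eventually — parabolic smoothing of bounded (Type-I) mild
  solutions [literature-grade; e.g. the `L^∞` gradient estimates for mild solutions, Giga–Sawada type, applied on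
  windows of length `≍ (T−t)`; NOT proved here];
* (Λ) LERAY'S LOWER RATE `c₀√ν ≤ √(T−t)·‖u(t,x_t)‖` at some point `x_t`, for every `t < T` [Leray 1934 §19 for
  a solution that does not extend smoothly past `T`; NOT proved here];
* (E) LERAY-RATE ENSTROPHY AT EFFICIENT TIMES: for some `A`, for every efficiency level `0 ≤ m < κ⋆` and onset
  `t₁`, the late times that are strictly `m`-efficient AND have `Z(t)·√(T−t) ≤ A·ν√ν` are non-null — the
  genuinely OPEN content (a vorticity-concentration statement: enstrophy within a constant of Leray's MINIMAL
  blow-up rate at the efficient times; its efficiency half alone is the landed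
  `nearEfficient_recurrence_of_not_perFlow`).

* `scaleLock_of_rates` — (G) ∧ (Λ) ∧ (E) ⇒ `∃ 0 < c₁ ≤ c₂` such that for every `0 ≤ m < κ⋆` and `t₁ ∈ [0,T)` the
  set of `t ∈ [t₁,T)` that are strictly `m`-efficient with `c₁ν(T−t)P ≤ Z ≤ c₂ν(T−t)P` is non-null.
  Mechanism: at an `m*`-efficient time (`m* = max m κ⋆/4`) the landed CAP `m*²M²P ≤ B²Z`
  (`palinstrophy_le_of_efficient`) with `B = C₁/(T−t)` and `M ≥ c₀√(ν/(T−t))` gives the upper lock with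
  `c₁ = (κ⋆c₀/4)²/C₁²`; the landed FLOOR `(m*M)⁴ ≤ c_L⁴ZP` (`zp_lower_of_efficient`) with `Z√(T−t) ≤ Aν√ν` gives
  the lower lock with `c₂ = A²c_L⁴(4/(κ⋆c₀))⁴` (then `max`ed with `c₁`).

HONEST FRAMING: a conditional reduction; (G), (Λ), (E) are hypotheses, not theorems of this file; no lock, no
depletion and nothing about Navier–Stokes regularity or blow-up is proved; items 26567/26568 stay open.
References: Leray 1934 §19; Giga–Sawada (2003) / Dong–Zhang arXiv:1907.01687 (smoothing of bounded mild
solutions); Robinson–Rodrigo–Sadowski 2016 (6.7). [folklore]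
-/

noncomputable section
open Set Filter Topology MeasureTheory
open scoped InnerProductSpace RealInnerProductSpace ENNReal NNReal ContDiff
open Literature.Analysis.FluidPDE

namespace Summit.NavierStokesRegularity.NavierStokesRegularity.Theorems.DepletionLadder.PerFlow
set_option linter.dupNamespace false
set_option linter.style.longLine false

open Summit.NavierStokesRegularity.NavierStokesRegularity.Theorems.EnstrophyBudget (isLocalSolution sobolev_slice)

/-- **The scale lock from (G) gradient Type-I rate, (Λ) Leray's lower rate and (E) Leray-rate enstrophy at
efficient times.** See the module docstring. [folklore] -/
theorem scaleLock_of_rates {ν T : ℝ} (hν : 0 < ν) (hT : 0 < T)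
    {u : ℝ → EuclideanSpace ℝ (Fin 3) → EuclideanSpace ℝ (Fin 3)} {p : ℝ → EuclideanSpace ℝ (Fin 3) → ℝ}
    (hsol : IsClassicalNSSolutionOn (Ico 0 T) ν 0 u p) (hLH : IsLerayHopfOn T ν 0 (u 0) u)
    (hdec : HasRapidSpatialDecay (u 0))
    (hgrad : ∃ C₁ : ℝ, 0 < C₁ ∧ ∀ᶠ t in 𝓝[<] T, ∀ x, (T - t) * ‖fderiv ℝ (u t) x‖ ≤ C₁)
    (hleray : ∃ c₀ : ℝ, 0 < c₀ ∧ ∀ t ∈ Set.Ico 0 T, ∃ x, c₀ * Real.sqrt ν ≤ Real.sqrt (T - t) * ‖u t x‖)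
    (henst : ∃ A : ℝ, ∀ m : ℝ, 0 ≤ m → m < sInf {κ : ℝ | (∀ (v : EuclideanSpace ℝ (Fin 3) → EuclideanSpace ℝ (Fin 3)) (M B : ℝ), ContDiff ℝ (⊤ : ℕ∞) v → Literature.Analysis.FluidPDE.VectorCalculus.IsDivFree v → (∀ x, ‖v x‖ ≤ M) → (∀ x, ‖fderiv ℝ v x‖ ≤ B) → (∫⁻ x, ‖iteratedFDeriv ℝ 0 v x‖ₑ ^ 2 < ⊤) → (∫⁻ x, ‖iteratedFDeriv ℝ 1 v x‖ₑ ^ 2 < ⊤) → (∫⁻ x, ‖iteratedFDeriv ℝ 2 v x‖ₑ ^ 2 < ⊤) → |∫ x, ⟪Literature.Analysis.FluidPDE.curl v x, fderiv ℝ v x (Literature.Analysis.FluidPDE.curl v x)⟫_ℝ| ≤ κ * M * Real.sqrt (∫ x, ‖Literature.Analysis.FluidPDE.curl v x‖ ^ 2) * Real.sqrt (∫ x, Literature.Analysis.FluidPDE.frobeniusNormSq (fderiv ℝ (Literature.Analysis.FluidPDE.curl v) x)))} → ∀ t₁ ∈ Set.Ico 0 T,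
      volume {t : ℝ | t ∈ Set.Ico t₁ T ∧ (∃ M : ℝ, (∀ x, ‖u t x‖ ≤ M) ∧ m * M * Real.sqrt (∫ x, ‖Literature.Analysis.FluidPDE.curl (u t) x‖ ^ 2) * Real.sqrt (∫ x, Literature.Analysis.FluidPDE.frobeniusNormSq (fderiv ℝ (Literature.Analysis.FluidPDE.curl (u t)) x)) < |∫ x, ⟪Literature.Analysis.FluidPDE.curl (u t) x, fderiv ℝ (u t) x (Literature.Analysis.FluidPDE.curl (u t) x)⟫_ℝ|) ∧ (∫ x, ‖Literature.Analysis.FluidPDE.curl (u t) x‖ ^ 2) * Real.sqrt (T - t) ≤ A * (ν * Real.sqrt ν)} ≠ 0) :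
    ∃ c₁ c₂ : ℝ, 0 < c₁ ∧ c₁ ≤ c₂ ∧ ∀ m : ℝ, 0 ≤ m → m < sInf {κ : ℝ | (∀ (v : EuclideanSpace ℝ (Fin 3) → EuclideanSpace ℝ (Fin 3)) (M B : ℝ), ContDiff ℝ (⊤ : ℕ∞) v → Literature.Analysis.FluidPDE.VectorCalculus.IsDivFree v → (∀ x, ‖v x‖ ≤ M) → (∀ x, ‖fderiv ℝ v x‖ ≤ B) → (∫⁻ x, ‖iteratedFDeriv ℝ 0 v x‖ₑ ^ 2 < ⊤) → (∫⁻ x, ‖iteratedFDeriv ℝ 1 v x‖ₑ ^ 2 < ⊤) → (∫⁻ x, ‖iteratedFDeriv ℝ 2 v x‖ₑ ^ 2 < ⊤) → |∫ x, ⟪Literature.Analysis.FluidPDE.curl v x, fderiv ℝ v x (Literature.Analysis.FluidPDE.curl v x)⟫_ℝ| ≤ κ * M * Real.sqrt (∫ x, ‖Literature.Analysis.FluidPDE.curl v x‖ ^ 2) * Real.sqrt (∫ x, Literature.Analysis.FluidPDE.frobeniusNormSq (fderiv ℝ (Literature.Analysis.FluidPDE.curl v) x)))} → ∀ t₁ ∈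 Set.Ico 0 T,
      volume {t : ℝ | t ∈ Set.Ico t₁ T ∧ (∃ M : ℝ, (∀ x, ‖u t x‖ ≤ M) ∧ m * M * Real.sqrt (∫ x, ‖Literature.Analysis.FluidPDE.curl (u t) x‖ ^ 2) * Real.sqrt (∫ x, Literature.Analysis.FluidPDE.frobeniusNormSq (fderiv ℝ (Literature.Analysis.FluidPDE.curl (u t)) x)) < |∫ x, ⟪Literature.Analysis.FluidPDE.curl (u t) x, fderiv ℝ (u t) x (Literature.Analysis.FluidPDE.curl (u t) x)⟫_ℝ|) ∧ c₁ * (ν * (T - t)) * (∫ x, Literature.Analysis.FluidPDE.frobeniusNormSq (fderiv ℝ (Literature.Analysis.FluidPDE.curl (u t)) x)) ≤ (∫ x, ‖Literature.Analysis.FluidPDE.curl (u t) x‖ ^ 2) ∧ (∫ x, ‖Literature.Analysis.FluidPDE.curl (u t) x‖ ^ 2) ≤ c₂ * (ν * (T - t)) * (∫ x, Literature.Analysis.FluidPDE.frobeniusNormSq (fderiv ℝ (Literature.Analysis.FluidPDE.curl (u t)) x))} ≠ 0 := by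
  obtain ⟨C₁, hC₁, hgrad⟩ := hgrad
  obtain ⟨c₀, hc₀, hleray⟩ := hleray
  obtain ⟨A, henst⟩ := henst
  set kstar : ℝ := sInf {κ : ℝ | (∀ (v : EuclideanSpace ℝ (Fin 3) → EuclideanSpace ℝ (Fin 3)) (M B : ℝ), ContDiff ℝ (⊤ : ℕ∞) v → Literature.Analysis.FluidPDE.VectorCalculus.IsDivFree v → (∀ x, ‖v x‖ ≤ M) → (∀ x, ‖fderiv ℝ v x‖ ≤ B) → (∫⁻ x, ‖iteratedFDeriv ℝ 0 v x‖ₑ ^ 2 < ⊤) → (∫⁻ x, ‖iteratedFDeriv ℝ 1 v x‖ₑ ^ 2 < ⊤) → (∫⁻ x, ‖iteratedFDeriv ℝ 2 v x‖ₑ ^ 2 < ⊤) → |∫ x, ⟪Literature.Analysis.FluidPDE.curl v x, fderiv ℝ v x (Literature.Analysis.FluidPDE.curl v x)⟫_ℝ| ≤ κ * M * Real.sqrt (∫ x, ‖Literature.Analysis.FluidPDE.curl v x‖ ^ 2) * Real.sqrt (∫ x, Literature.Analysis.FluidPDE.frobeniusNormSq (fderiv ℝ (Literature.Analysis.FluidPDE.curl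 v) x)))} with hkstar
  have hkpos : 0 < kstar := lt_trans (by norm_num) DepletionLadder.sharpDepletion_gt
  set cL : ℝ := ((SNormLESNormFDerivOfEqConst (EuclideanSpace ℝ (Fin 3)) (volume : Measure (EuclideanSpace ℝ (Fin 3))) 2 : ℝ) ^ 3 + 1) with hcL
  have hcL0 : 0 < cL := by rw [hcL]; positivity
  set m₀ : ℝ := kstar / 4 with hm₀
  have hm₀pos : 0 < m₀ := by rw [hm₀]; positivity
  set c₁ : ℝ := (m₀ * c₀) ^ 2 / C₁ ^ 2 with hc₁
  set c₂ : ℝ := A ^ 2 * cL ^ 4 / (m₀ * c₀) ^ 4 with hc₂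
  have hc₁pos : 0 < c₁ := by rw [hc₁]; positivity
  refine ⟨c₁, max c₂ c₁, hc₁pos, le_max_right _ _, ?_⟩
  intro m hm0 hm t₁ ht₁ hnull
  have hloc := isLocalSolution hν hT hsol hLH hdec
  -- onset of the gradient rate
  obtain ⟨a, haT, hsub⟩ := mem_nhdsLT_iff_exists_Ioo_subset.1 hgrad
  have haT' : a < T := haT
  set t₁' : ℝ := max t₁ ((a + T) / 2) with ht₁'
  have ht₁'T : t₁' < T := max_lt ht₁.2 (by linarith [haT'])
  have ht₁'0 : 0 ≤ t₁' := ht₁.1.trans (le_max_left _ _)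
  have ht₁t₁' : t₁ ≤ t₁' := le_max_left _ _
  have hat₁' : a < t₁' := lt_of_lt_of_le (by linarith [haT'] : a < (a + T) / 2) (le_max_right _ _)
  -- the efficiency level actually used
  set m' : ℝ := max m m₀ with hm'
  have hm'0 : 0 ≤ m' := hm0.trans (le_max_left _ _)
  have hm'pos : 0 < m' := lt_of_lt_of_le hm₀pos (le_max_right _ _)
  have hm'lt : m' < kstar := max_lt hm (by rw [hm₀]; linarith)
  have hm₀le : m₀ ≤ m' := le_max_right _ _
  have hmle : m ≤ m' := le_max_left _ _
  -- the (E)-set at level m' from onset t₁' is contained in the target set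
  refine henst m' hm'0 hm'lt t₁' ⟨ht₁'0, ht₁'T⟩ (measure_mono_null ?_ hnull)
  rintro t ⟨ht, ⟨M, hM, heff⟩, hZA⟩
  have htT : t ∈ Set.Ico 0 T := ⟨ht₁'0.trans ht.1, ht.2⟩
  have hTt : 0 < T - t := sub_pos.2 ht.2
  have hsT : 0 < Real.sqrt (T - t) := Real.sqrt_pos.2 hTt
  -- slice data
  set Zt : ℝ := (∫ x, ‖Literature.Analysis.FluidPDE.curl (u t) x‖ ^ 2) with hZt
  set Pt : ℝ := (∫ x, Literature.Analysis.FluidPDE.frobeniusNormSq (fderiv ℝ (Literature.Analysis.FluidPDE.curl (u t)) x)) with hPt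
  have hZ0 : 0 ≤ Zt := integral_nonneg fun x => by positivity
  have hP0 : 0 ≤ Pt := integral_nonneg fun x => frobeniusNormSq_nonneg _
  have hM0 : 0 ≤ M := (norm_nonneg _).trans (hM 0)
  have hv2 : ContDiff ℝ 2 (u t) := (hsol.contDiff_velocity htT).of_le (by norm_cast)
  have hv3 : ContDiff ℝ 3 (u t) := (hsol.contDiff_velocity htT).of_le (by norm_cast)
  have hdiv : VectorCalculus.IsDivFree (u t) := hsol.divFree _ htT
  have h1 := sobolev_slice hloc htT 1
  have h2 := sobolev_slice hloc htT 2
  have h0 : ∫⁻ x, ‖u t x‖ₑ ^ 2 < ⊤ := by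
    have h := sobolev_slice hloc htT 0
    have heq : (fun x => ‖iteratedFDeriv ℝ 0 (u t) x‖ₑ ^ 2) = fun x => ‖u t x‖ₑ ^ 2 := by
      funext x
      rw [← ofReal_norm, ← ofReal_norm, norm_iteratedFDeriv_zero]
    simpa only [heq] using h
  -- m'-efficiency from m... no: the (E)-set is at level m' already; m-efficiency follows from m ≤ m'
  have hprod0 : 0 ≤ M * Real.sqrt Zt * Real.sqrt Pt := by positivity
  have heffm : m * M * Real.sqrt Zt * Real.sqrt Pt < |∫ x, ⟪Literature.Analysis.FluidPDE.curl (u t) x, fderiv ℝ (u t) x (Literature.Analysis.FluidPDE.curl (u t) x)⟫_ℝ| := by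
    calc m * M * Real.sqrt Zt * Real.sqrt Pt = m * (M * Real.sqrt Zt * Real.sqrt Pt) := by ring
      _ ≤ m' * (M * Real.sqrt Zt * Real.sqrt Pt) := mul_le_mul_of_nonneg_right hmle hprod0
      _ = m' * M * Real.sqrt Zt * Real.sqrt Pt := by ring
      _ < _ := heff
  -- gradient bound at t
  have htIoo : t ∈ Set.Ioo a T := ⟨hat₁'.trans_le ht.1, ht.2⟩
  have hgradt : ∀ x, (T - t) * ‖fderiv ℝ (u t) x‖ ≤ C₁ := hsub htIoo
  have hBt : ∀ x, ‖fderiv ℝ (u t) x‖ ≤ C₁ / (T - t) := fun x => by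
    rw [le_div_iff₀ hTt, mul_comm]; exact hgradt x
  -- Leray at t: c₀√ν ≤ √(T−t) M
  obtain ⟨x₀, hx₀⟩ := hleray t htT
  have hLM : c₀ * Real.sqrt ν ≤ Real.sqrt (T - t) * M :=
    hx₀.trans (mul_le_mul_of_nonneg_left (hM x₀) hsT.le)
  have hLM2 : c₀ ^ 2 * ν ≤ (T - t) * M ^ 2 := by
    have h := pow_le_pow_left₀ (by positivity) hLM 2
    rw [mul_pow, mul_pow, Real.sq_sqrt hν.le, Real.sq_sqrt hTt.le] at h
    exact h
  have hLM4 : c₀ ^ 4 * ν ^ 2 ≤ (T - t) ^ 2 * M ^ 4 := by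
    have h := pow_le_pow_left₀ (by positivity) hLM2 2
    calc c₀ ^ 4 * ν ^ 2 = (c₀ ^ 2 * ν) ^ 2 := by ring
      _ ≤ ((T - t) * M ^ 2) ^ 2 := h
      _ = (T - t) ^ 2 * M ^ 4 := by ring
  -- CAP: m'² M² P ≤ (C₁/(T−t))² Z
  have hcap : m' ^ 2 * M ^ 2 * Pt ≤ (C₁ / (T - t)) ^ 2 * Zt :=
    palinstrophy_le_of_efficient hv2 h1 hm'pos hM hBt heff
  -- FLOOR: (m' M)⁴ ≤ cL⁴ Z P
  have hfloor : (m' * M) ^ 4 ≤ cL ^ 4 * Zt * Pt :=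
    zp_lower_of_efficient hv3 hdiv h0 h1 h2 hm'0 hM heff
  refine ⟨⟨ht₁t₁'.trans ht.1, ht.2⟩, ⟨M, hM, heffm⟩, ?_, ?_⟩
  · -- upper lock: c₁ ν (T−t) P ≤ Z, c₁ = (m₀c₀)²/C₁²
    have key : (m₀ * c₀) ^ 2 * (ν * (T - t)) * Pt ≤ C₁ ^ 2 * Zt := by
      have h1' : (m₀ * c₀) ^ 2 * (ν * (T - t)) * Pt = m₀ ^ 2 * (c₀ ^ 2 * ν) * (T - t) * Pt := by ring
      have h2' : m₀ ^ 2 * (c₀ ^ 2 * ν) * (T - t) * Pt ≤ m' ^ 2 * ((T - t) * M ^ 2) * (T - t) * Pt := by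
        apply mul_le_mul_of_nonneg_right _ hP0
        apply mul_le_mul_of_nonneg_right _ hTt.le
        exact mul_le_mul (pow_le_pow_left₀ hm₀pos.le hm₀le 2) hLM2 (by positivity) (by positivity)
      have h3' : m' ^ 2 * ((T - t) * M ^ 2) * (T - t) * Pt = (m' ^ 2 * M ^ 2 * Pt) * (T - t) ^ 2 := by ring
      have h4' : (m' ^ 2 * M ^ 2 * Pt) * (T - t) ^ 2 ≤ ((C₁ / (T - t)) ^ 2 * Zt) * (T - t) ^ 2 :=
        mul_le_mul_of_nonneg_right hcap (by positivity)
      have h5' : ((C₁ / (T - t)) ^ 2 * Zt) * (T - t) ^ 2 = C₁ ^ 2 * Zt := by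
        field_simp
      calc (m₀ * c₀) ^ 2 * (ν * (T - t)) * Pt = m₀ ^ 2 * (c₀ ^ 2 * ν) * (T - t) * Pt := h1'
        _ ≤ m' ^ 2 * ((T - t) * M ^ 2) * (T - t) * Pt := h2'
        _ = (m' ^ 2 * M ^ 2 * Pt) * (T - t) ^ 2 := h3'
        _ ≤ ((C₁ / (T - t)) ^ 2 * Zt) * (T - t) ^ 2 := h4'
        _ = C₁ ^ 2 * Zt := h5'
    have hC₁2 : 0 < C₁ ^ 2 := by positivity
    calc c₁ * (ν * (T - t)) * Pt = ((m₀ * c₀) ^ 2 * (ν * (T - t)) * Pt) / C₁ ^ 2 := by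
          rw [hc₁]; ring
      _ ≤ (C₁ ^ 2 * Zt) / C₁ ^ 2 := div_le_div_of_nonneg_right key hC₁2.le
      _ = Zt := by field_simp
  · -- lower lock: Z ≤ c₂ ν (T−t) P with c₂ = A² cL⁴/(m₀c₀)⁴, then ≤ max c₂ c₁
    have hZs0 : 0 ≤ Zt * Real.sqrt (T - t) := by positivity
    have hZA' : (Zt * Real.sqrt (T - t)) ^ 2 ≤ (A * (ν * Real.sqrt ν)) ^ 2 := pow_le_pow_left₀ hZs0 hZA 2
    have hF2 : Zt ^ 2 * (T - t) ≤ A ^ 2 * ν ^ 3 := by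
      calc Zt ^ 2 * (T - t) = (Zt * Real.sqrt (T - t)) ^ 2 := by rw [mul_pow, Real.sq_sqrt hTt.le]
        _ ≤ (A * (ν * Real.sqrt ν)) ^ 2 := hZA'
        _ = A ^ 2 * ν ^ 3 := by rw [mul_pow, mul_pow, Real.sq_sqrt hν.le]; ring
    have hF1 : (m₀ * c₀) ^ 4 * ν ^ 2 ≤ cL ^ 4 * Zt * Pt * (T - t) ^ 2 := by
      calc (m₀ * c₀) ^ 4 * ν ^ 2 = m₀ ^ 4 * (c₀ ^ 4 * ν ^ 2) := by ring
        _ ≤ m' ^ 4 * ((T - t) ^ 2 * M ^ 4) :=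
            mul_le_mul (pow_le_pow_left₀ hm₀pos.le hm₀le 4) hLM4 (by positivity) (by positivity)
        _ = (m' * M) ^ 4 * (T - t) ^ 2 := by ring
        _ ≤ (cL ^ 4 * Zt * Pt) * (T - t) ^ 2 := mul_le_mul_of_nonneg_right hfloor (by positivity)
        _ = cL ^ 4 * Zt * Pt * (T - t) ^ 2 := by ring
    have key : Zt * ((m₀ * c₀) ^ 4 * ν ^ 2) ≤ (c₂ * (ν * (T - t)) * Pt) * ((m₀ * c₀) ^ 4 * ν ^ 2) := by
      calc Zt * ((m₀ * c₀) ^ 4 * ν ^ 2) ≤ Zt * (cL ^ 4 * Zt * Pt * (T - t) ^ 2) :=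
            mul_le_mul_of_nonneg_left hF1 hZ0
        _ = (cL ^ 4 * Pt * (T - t)) * (Zt ^ 2 * (T - t)) := by ring
        _ ≤ (cL ^ 4 * Pt * (T - t)) * (A ^ 2 * ν ^ 3) := mul_le_mul_of_nonneg_left hF2 (by positivity)
        _ = (c₂ * (ν * (T - t)) * Pt) * ((m₀ * c₀) ^ 4 * ν ^ 2) := by
            rw [hc₂]; field_simp
    have hpos : 0 < (m₀ * c₀) ^ 4 * ν ^ 2 := by positivity
    have hZle : Zt ≤ c₂ * (ν * (T - t)) * Pt := le_of_mul_le_mul_right key hpos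
    calc Zt ≤ c₂ * (ν * (T - t)) * Pt := hZle
      _ ≤ max c₂ c₁ * (ν * (T - t)) * Pt := by
          apply mul_le_mul_of_nonneg_right _ hP0
          exact mul_le_mul_of_nonneg_right (le_max_left _ _) (by positivity)

end Summit.NavierStokesRegularity.NavierStokesRegularity.Theorems.DepletionLadder.PerFlow

end
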